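import Mathlib
import Literature.Analysis.FluidPDE.VectorCalculus
import Literature.Analysis.FluidPDE.VorticityCalculus
import Literature.Analysis.FluidPDE.LandauSolutions
import Literature.Analysis.FluidPDE.PineauVicolAngularMean
import Summits.NavierStokesRegularity.NavierStokesRegularity.Theorems.ThreadingFluxCentreJetRigidityReductionSharp
import Summits.NavierStokesRegularity.NavierStokesRegularity.Theorems.ThreadingFluxSilentShellsTwoAxesTools
import Summits.NavierStokesRegularity.NavierStokesRegularity.Theorems.ThreadingFluxAzimuthalCartanDefs
import HarnessLib

/-!
# Crux `PoloidalLiouville` (stmt-NavierStokesRegularity-1222, wall W1), crux idea «azimuthal-cartan-test» (ns-idea-15 g10,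
# `Cruxes/PoloidalLiouville/AzimuthalCartanSketch.lean` v1.2): the reduction R♯ `ShellReduction` — STEADY SHELL RIGIDITY (C♯)
# DECIDES THE STEADY STRATUM OF 1222 — as a kernel theorem, unconditionally

Support file (Theorems-side; seat ns-wall-eng-6 g4, cell `ns-wall-extremal`, W1 adjunct; `--supports stmt-NavierStokesRegularity-1222
--as helper`; 0 kit).  The card's chain of record (v1.2) is C♯ `SteadyShellRigidity` → R♯ `ShellReduction` → `SteadyUnthreadedLiouville'`;
this file proves R♯ BY NAME over the Theorems-side Defs twin `ThreadingFluxAzimuthalCartanDefs.lean`: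

* `AzimuthalCartan.shellReduction : ShellReduction` (= `SteadyShellRigidity → SteadyUnthreadedLiouville'`), via the explicit-binder form
  `AzimuthalCartan.steadyUnthreadedLiouville_of_steadyShellRigidity`.

PROOF (the sketch's docstring plan, every analytic input BY NAME from the tree).  Let `V, p` be a bounded classical steady Navier–Stokes
flow on `ℝ³`, unthreaded about `x₀`.  (1) `V` and `p` are real-analytic on `ℝ³` (`CentreJet.analyticOnNhd_of_isSteadyNSOn_univ`,
`CentreJet.analyticOnNhd_pressure_of_isSteadyNSOn_univ` — ns-wall-eng-7 g5, from the tree's bounded-steady-flow theory and the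
analytic-primitive lemma).  (2) If `curl V ≡ 0`: `CentreJet.irrotationalSteadyLiouville`.  (3) Otherwise `curl V ≠ 0` at some `x₂ ≠ x₀`
(`exists_ne_curl_ne_zero`, openness of `{curl V ≠ 0}`); apply C♯ on the shell `d/2 < |x − x₀| < 2d`, `d = |x₂ − x₀|`: a skew `A ≠ 0` with
`DV(x)(A(x − x₀)) = A V(x)` and `⟪V x, A(x − x₀)⟫ = κ` on the shell.  Both defects are real-analytic on `ℝ³` and vanish on the OPEN shell,
hence on `ℝ³` (identity principle `AnalyticOnNhd.eqOn_zero_of_preconnected_of_eventuallyEq_zero` on `univ` — no connectedness of the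
shell is needed), and `κ = 0` by reading the swirl identity at `x = x₀`.  (4) `A = μ • (a × ·)` with `|a| = 1`, `μ ≠ 0`
(`SilentShells.TwoAxes.exists_cross_of_skew`, polarisation `inner_skew_of_inner_self_eq_zero`); take a linear isometry `g` with `g e₃ = a`
(`exists_linearIsometryEquiv_apply_eZ_eq` — a reflection, so instead of transporting cross products we CONJUGATE THE GENERATOR:
`B' = g⁻¹ ∘ (a × ·) ∘ g` is skew and kills `e₃`, hence `B' = c • rotGen`, `c ≠ 0`, `eq_smul_rotGen_of_skew_of_apply_eZ`); the conjugated
field `W = g⁻¹ V(x₀ + g ·)` then satisfies `DW(y)[e₃ × y] = e₃ × W(y)` and `swirl W = 0`.  (5) INTEGRATING THE ROTATION FLOW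
(`isAxisymmetric_of_fderiv_rotGen`, the one new formal step): `θ ↦ R_{−θ} W(R_θ y)` has derivative `−R_{−θ}(rotGen (W z) − DW(z)[rotGen z])
= 0` (tree `hasDerivAt_rotZ_neg_comp_rotZ`, Pineau–Vicol §6.1), so `W (R_θ y) = R_θ (W y)`.  (6) The engine `CentreJet.eq_const_of_local_symmetry`
fed with the tree's DISCHARGED facts `CentreJet.steadyNSGradientBounds` (F2) and `CentreJet.steadyClassicalIsMild` (G1) — KNSS 2009 Thm 5.2
(`knss_axisymmetric_no_swirl'_holds`) — makes `V` constant.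

HONEST LABEL: a reduction between typed statements of one idea card; the load-bearing statement C♯ `SteadyShellRigidity` is a CONJECTURE
of the card (exact linearised jet-count evidence on solid tori only) and is NOT touched here; `SteadyUnthreadedLiouville'` (the steady
stratum of W1), `PoloidalLiouville` (1222), `UnthreadedRigidity` (27585) and NS regularity remain OPEN; information-grade (movement 0).
[cite: KochNadirashviliSereginSverak2009, Thm 5.2 (arXiv pp. 9–10)] [cite: PineauVicol2026, §6.1 (6.2)]
-/

-- the summit and its single problem share the name (D-0017 nested layout)
set_option linter.dupNamespace false

noncomputable section

open Set Function Filter Metric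
open scoped RealInnerProductSpace Topology
open Literature.Analysis.FluidPDE
open Summit.NavierStokesRegularity.NavierStokesRegularity.Theorems.PoloidalLiouville.CentreJet
  (E3 IsUnthreadedAbout IsSteadyNSOn)

namespace Summit.NavierStokesRegularity.NavierStokesRegularity.Theorems.PoloidalLiouville.AzimuthalCartan

/-! ### Elementary facts -/

/-- Evaluation `x ↦ f x (g x)` of an analytic operator field at an analytic vector field is analytic. -/
theorem analyticOnNhd_clm_apply {f : E3 → E3 →L[ℝ] E3} {g : E3 → E3} {s : Set E3} (hf : AnalyticOnNhd ℝ f s)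
    (hg : AnalyticOnNhd ℝ g s) : AnalyticOnNhd ℝ (fun x => f x (g x)) s :=
  ((ContinuousLinearMap.id ℝ (E3 →L[ℝ] E3)).analyticOnNhd_bilinear univ).comp (hf.prod hg) (mapsTo_univ _ _)

/-- The inner product `x ↦ ⟪f x, g x⟫` of two analytic vector fields is analytic. -/
theorem analyticOnNhd_inner {f g : E3 → E3} {s : Set E3} (hf : AnalyticOnNhd ℝ f s) (hg : AnalyticOnNhd ℝ g s) :
    AnalyticOnNhd ℝ (fun x => ⟪f x, g x⟫) s :=
  ((innerSL ℝ (E := E3)).analyticOnNhd_bilinear univ).comp (hf.prod hg) (mapsTo_univ _ _)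

/-- The spherical shell is open. -/
theorem isOpen_shell (x₀ : E3) (r₁ r₂ : ℝ) : IsOpen (shell x₀ r₁ r₂) := by
  have hc : Continuous fun x : E3 => dist x x₀ := continuous_id.dist continuous_const
  exact (isOpen_lt continuous_const hc).inter (isOpen_lt hc continuous_const)

/-- Polarisation: a linear map with `⟪A x, x⟫ = 0` for all `x` is skew-adjoint. -/
theorem inner_skew_of_inner_self_eq_zero (A : E3 →L[ℝ] E3) (hA : ∀ x : E3, ⟪A x, x⟫ = 0) (x y : E3) :
    ⟪A x, y⟫ = -⟪x, A y⟫ := by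
  have h := hA (x + y)
  rw [map_add, inner_add_left, inner_add_right, inner_add_right, hA x, hA y, zero_add, add_zero] at h
  rw [real_inner_comm (A y) x]
  linarith

/-- A non-zero skew endomorphism of `ℝ³` is a non-zero multiple of the cross product with a UNIT vector. -/
theorem exists_unit_axis_of_isSkewAxis {A : E3 →L[ℝ] E3} (hA : IsSkewAxis A) :
    ∃ (a : E3) (μ : ℝ), ‖a‖ = 1 ∧ μ ≠ 0 ∧ ∀ x, A x = μ • cross a x := by
  obtain ⟨w, hw⟩ := SilentShells.TwoAxes.exists_cross_of_skew A (inner_skew_of_inner_self_eq_zero A hA.1)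
  have hw0 : w ≠ 0 := by
    intro h0
    apply hA.2
    ext x i
    rw [hw x, h0]
    simp [cross, crossProduct]
  refine ⟨‖w‖⁻¹ • w, ‖w‖, ?_, norm_ne_zero_iff.2 hw0, fun x => ?_⟩
  · rw [norm_smul, norm_inv, norm_norm, inv_mul_cancel₀ (norm_ne_zero_iff.2 hw0)]
  · have h1 : cross (‖w‖⁻¹ • w) x = ‖w‖⁻¹ • cross w x := by
      rw [← crossCLM_apply, ← crossCLM_apply, map_smul]; rfl
    rw [hw x, h1, smul_smul, mul_inv_cancel₀ (norm_ne_zero_iff.2 hw0), one_smul]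

/-- A skew endomorphism of `ℝ³` killing `e₃` is a multiple of the rotation generator `rotGen = e₃ × ·`. -/
theorem eq_smul_rotGen_of_skew_of_apply_eZ {B : E3 →L[ℝ] E3} (hB : ∀ x y : E3, ⟪B x, y⟫ = -⟪x, B y⟫)
    (hBe : B eZ = 0) : ∃ c : ℝ, ∀ y, B y = c • rotGen y := by
  obtain ⟨w, hw⟩ := SilentShells.TwoAxes.exists_cross_of_skew B hB
  have h0 : w 1 = 0 ∧ w 0 = 0 := by
    have h := hw eZ
    rw [hBe] at h
    have h1 := congrFun (congrArg (fun v : E3 => (v : Fin 3 → ℝ)) h) 0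
    have h2 := congrFun (congrArg (fun v : E3 => (v : Fin 3 → ℝ)) h) 1
    simp [cross, crossProduct, eZ] at h1 h2
    exact ⟨by linarith, by linarith⟩
  refine ⟨w 2, fun y => ?_⟩
  rw [hw y]
  ext i
  fin_cases i
  · simp [cross, crossProduct, rotGen, h0.1]
  · simp [cross, crossProduct, rotGen, h0.2]
  · simp [cross, crossProduct, rotGen, h0.1, h0.2]

/-- If the vorticity of a `C¹` field is non-zero somewhere, it is non-zero at a point different from any prescribed `x₀`. -/
theorem exists_ne_curl_ne_zero {V : E3 → E3} (hV : ContDiff ℝ 1 V) (x₀ : E3) {x₁ : E3} (hx₁ : curl V x₁ ≠ 0) :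
    ∃ x₂ : E3, x₂ ≠ x₀ ∧ curl V x₂ ≠ 0 := by
  by_cases hne : x₁ = x₀
  · subst hne
    have hopen : IsOpen {x : E3 | curl V x ≠ 0} := isOpen_ne_fun (continuous_curl hV) continuous_const
    obtain ⟨ε, hε, hball⟩ := Metric.isOpen_iff.1 hopen x₁ hx₁
    refine ⟨x₁ + (ε / 2) • eZ, ?_, hball ?_⟩
    · intro h
      have h' : (ε / 2) • (eZ : E3) = 0 := by
        have := congrArg (fun z => z - x₁) h
        simpa using this
      rw [smul_eq_zero] at h'
      rcases h' with h' | h'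
      · linarith
      · have := congrFun (congrArg (fun v : E3 => (v : Fin 3 → ℝ)) h') 2
        simp [eZ] at this
    · rw [Metric.mem_ball, dist_eq_norm, add_sub_cancel_left, norm_smul, Real.norm_of_nonneg (by positivity)]
      have : ‖(eZ : E3)‖ = 1 := by
        simp [eZ]
      rw [this, mul_one]
      linarith
  · exact ⟨x₁, hne, hx₁⟩

/-! ### Integrating the rotation flow -/

/-- **Infinitesimal ⇒ finite rotational symmetry.**  A `C¹` field on `ℝ³` with `DW(y)[e₃ × y] = e₃ × W(y)` for all `y`
is axisymmetric: `W (R_θ y) = R_θ (W y)` (the pulled-back orbit `θ ↦ R_{−θ} W(R_θ y)` has zero derivative). -/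
theorem isAxisymmetric_of_fderiv_rotGen {W : E3 → E3} (hW : ContDiff ℝ 1 W)
    (h : ∀ y : E3, fderiv ℝ W y (rotGen y) = rotGen (W y)) : IsAxisymmetric W := by
  intro θ y
  set φ : ℝ → E3 := fun t => rotZ (-t) (W (rotZ t y)) with hφ
  have hder : ∀ t, HasDerivAt φ 0 t := by
    intro t
    have hd := hasDerivAt_rotZ_neg_comp_rotZ hW y t
    rw [h (rotZ t y), sub_self] at hd
    have h0 : rotZ (-t) (0 : E3) = 0 := by ext i; fin_cases i <;> simp [rotZ]
    simpa [hφ, h0] using hd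
  have hconst := is_const_of_deriv_eq_zero (fun t => (hder t).differentiableAt) (fun t => (hder t).deriv) θ 0
  simp only [hφ, neg_zero, rotZ_zero] at hconst
  -- `R_{-θ} (W (R_θ y)) = W y`
  have := congrArg (rotZ θ) hconst
  rwa [← rotZ_add, add_neg_cancel, rotZ_zero] at this

/-! ### The reduction -/

/-- ★★ **R♯ `ShellReduction`, body verbatim: steady shell rigidity (C♯) decides the steady stratum of 1222.**
Given the (CONJECTURAL) statement that every analytic steady Navier–Stokes flow on a full spherical shell about `x₀`,
unthreaded about `x₀` there and with `curl ≢ 0`, is infinitesimally axisymmetric about an axis through `x₀` with constant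
swirl, every bounded classical steady Navier–Stokes flow on `ℝ³` unthreaded about a point is constant. -/
theorem steadyUnthreadedLiouville_of_steadyShellRigidity
    (hC : ∀ (V : E3 → E3) (p : E3 → ℝ) (x₀ : E3) (r₁ r₂ : ℝ), 0 < r₁ → r₁ < r₂ →
      AnalyticOnNhd ℝ V (shell x₀ r₁ r₂) → AnalyticOnNhd ℝ p (shell x₀ r₁ r₂) → IsSteadyNSOn (shell x₀ r₁ r₂) V p →
      IsUnthreadedOn (shell x₀ r₁ r₂) x₀ V → (∃ x ∈ shell x₀ r₁ r₂, curl V x ≠ 0) →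
      ∃ A : E3 →L[ℝ] E3, IsSkewAxis A ∧ IsEquivariantOn (shell x₀ r₁ r₂) x₀ A V ∧
        HasConstantSwirlOn (shell x₀ r₁ r₂) x₀ A V)
    (V : E3 → E3) (p : E3 → ℝ) (x₀ : E3) (hNS : IsSteadyNSOn univ V p) (hB : ∃ B : ℝ, ∀ x, ‖V x‖ ≤ B)
    (hun : IsUnthreadedAbout x₀ V) : ∃ b : E3, ∀ x, V x = b := by
  by_cases hirr : ∀ x, curl V x = 0
  · exact CentreJet.irrotationalSteadyLiouville V p hNS hB hirr
  push Not at hirr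
  obtain ⟨x₁, hx₁⟩ := hirr
  have hVan : AnalyticOnNhd ℝ V univ := CentreJet.analyticOnNhd_of_isSteadyNSOn_univ hNS hB
  have hpan : AnalyticOnNhd ℝ p univ := CentreJet.analyticOnNhd_pressure_of_isSteadyNSOn_univ hNS hB
  have hV3 : ContDiff ℝ 3 V := contDiffOn_univ.1 hNS.1
  have hV1 : ContDiff ℝ 1 V := hV3.of_le (by norm_num)
  have hVd : Differentiable ℝ V := hV1.differentiable one_ne_zero
  -- a point of non-zero vorticity off the centre, and a shell through it
  obtain ⟨x₂, hx₂ne, hx₂⟩ := exists_ne_curl_ne_zero hV1 x₀ hx₁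
  set d : ℝ := dist x₂ x₀ with hd
  have hd0 : 0 < d := dist_pos.2 hx₂ne
  have hx₂S : x₂ ∈ shell x₀ (d / 2) (2 * d) := by
    refine ⟨?_, ?_⟩ <;> simp only [← hd] <;> linarith
  obtain ⟨A, hAskew, hAeq, κ, hκ⟩ := hC V p x₀ (d / 2) (2 * d) (by linarith) (by linarith)
    (hVan.mono (subset_univ _)) (hpan.mono (subset_univ _)) (hNS.of_univ _) (fun x _ => hun x) ⟨x₂, hx₂S, hx₂⟩
  have hSopen : IsOpen (shell x₀ (d / 2) (2 * d)) := isOpen_shell _ _ _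
  have hSnhds : shell x₀ (d / 2) (2 * d) ∈ 𝓝 x₂ := hSopen.mem_nhds hx₂S
  -- (1) the equivariance defect is analytic on `ℝ³` and vanishes on the shell, hence everywhere
  have hAan : AnalyticOnNhd ℝ (fun x : E3 => A (x - x₀)) univ :=
    A.comp_analyticOnNhd (analyticOnNhd_id.sub analyticOnNhd_const)
  have hEq : ∀ x : E3, fderiv ℝ V x (A (x - x₀)) = A (V x) := by
    have hF : AnalyticOnNhd ℝ (fun x : E3 => fderiv ℝ V x (A (x - x₀)) - A (V x)) univ :=
      (analyticOnNhd_clm_apply hVan.fderiv hAan).sub (A.comp_analyticOnNhd hVan)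
    have hF0 : (fun x : E3 => fderiv ℝ V x (A (x - x₀)) - A (V x)) =ᶠ[𝓝 x₂] 0 := by
      filter_upwards [hSnhds] with x hx
      simp only [Pi.zero_apply, hAeq x hx, sub_self]
    intro x
    have := hF.eqOn_zero_of_preconnected_of_eventuallyEq_zero isPreconnected_univ (mem_univ x₂) hF0 (mem_univ x)
    exact sub_eq_zero.1 this
  -- (2) the swirl about the axis of `A` is the constant `κ` everywhere, and `κ = 0` (read at the centre)
  have hSw : ∀ x : E3, ⟪V x, A (x - x₀)⟫ = 0 := by
    have hG : AnalyticOnNhd ℝ (fun x : E3 => ⟪V x, A (x - x₀)⟫ - κ) univ := by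
      exact (analyticOnNhd_inner hVan hAan).sub analyticOnNhd_const
    have hG0 : (fun x : E3 => ⟪V x, A (x - x₀)⟫ - κ) =ᶠ[𝓝 x₂] 0 := by
      filter_upwards [hSnhds] with x hx
      simp only [Pi.zero_apply, hκ x hx, sub_self]
    have hall : ∀ x : E3, ⟪V x, A (x - x₀)⟫ = κ := fun x =>
      sub_eq_zero.1 (hG.eqOn_zero_of_preconnected_of_eventuallyEq_zero isPreconnected_univ (mem_univ x₂) hG0 (mem_univ x))
    have hκ0 : κ = 0 := by rw [← hall x₀]; simp
    intro x; rw [hall x, hκ0]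
  -- (3) the axis: `A = μ • (a × ·)`, `‖a‖ = 1`, `μ ≠ 0`; a frame `g` with `g e₃ = a`
  obtain ⟨a, μ, ha, hμ, hAx⟩ := exists_unit_axis_of_isSkewAxis hAskew
  obtain ⟨g, hga⟩ := exists_linearIsometryEquiv_apply_eZ_eq ha
  -- the conjugated generator `B' = g⁻¹ ∘ (a × ·) ∘ g` is skew and kills `e₃`, hence `B' = c • rotGen`, `c ≠ 0`
  set B' : E3 →L[ℝ] E3 :=
    (g.symm.toContinuousLinearEquiv : E3 →L[ℝ] E3).comp ((crossCLM a).comp (g.toContinuousLinearEquiv : E3 →L[ℝ] E3))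
    with hB'
  have hB'apply : ∀ y : E3, B' y = g.symm (cross a (g y)) := fun y => by simp [hB', crossCLM_apply]
  have hcross_skew : ∀ u v : E3, ⟪cross a u, v⟫ = -⟪u, cross a v⟫ := by
    have hs := inner_skew_of_inner_self_eq_zero A hAskew.1
    intro u v
    have h := hs u v
    rw [hAx u, hAx v, real_inner_smul_left, real_inner_smul_right] at h
    have h' : μ * ⟪cross a u, v⟫ = μ * (-⟪u, cross a v⟫) := by linarith
    exact mul_left_cancel₀ hμ h'
  have hginner : ∀ u v : E3, ⟪g.symm u, v⟫ = ⟪u, g v⟫ := fun u v => by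
    rw [← g.inner_map_map (g.symm u) v, g.apply_symm_apply]
  have hginner' : ∀ u v : E3, ⟪v, g.symm u⟫ = ⟪g v, u⟫ := fun u v => by
    rw [real_inner_comm, hginner, real_inner_comm]
  have hB'skew : ∀ x y : E3, ⟪B' x, y⟫ = -⟪x, B' y⟫ := by
    intro x y
    rw [hB'apply, hB'apply, hginner, hcross_skew, hginner']
  have hB'e : B' eZ = 0 := by
    rw [hB'apply, hga]
    have : cross a a = 0 := by
      ext i; fin_cases i <;> simp [cross, crossProduct] <;> ring
    rw [this, map_zero]
  obtain ⟨c, hc⟩ := eq_smul_rotGen_of_skew_of_apply_eZ hB'skew hB'e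
  have hc0 : c ≠ 0 := by
    intro h0
    -- then `B' = 0`, so `cross a ∘ g = 0`, so `cross a = 0`, contradicting `A ≠ 0`
    apply hAskew.2
    ext x i
    have h1 : B' (g.symm x) = 0 := by rw [hc, h0, zero_smul]
    rw [hB'apply, g.apply_symm_apply] at h1
    have h2 : cross a x = 0 := by simpa using congrArg g h1
    rw [hAx x, h2, smul_zero]
    rfl
  -- (4) the conjugated field `W = g⁻¹ V(x₀ + g ·)` is infinitesimally, hence genuinely, axisymmetric without swirl
  set W : E3 → E3 := fun y => g.symm (V (x₀ + g y)) with hW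
  have hWd : ∀ y, HasFDerivAt W ((g.symm.toContinuousLinearEquiv : E3 →L[ℝ] E3).comp
      ((fderiv ℝ V (x₀ + g y)).comp (g.toContinuousLinearEquiv : E3 →L[ℝ] E3))) y := by
    intro y
    have haff : HasFDerivAt (fun y : E3 => x₀ + g y) (g.toContinuousLinearEquiv : E3 →L[ℝ] E3) y := by
      simpa using ((g.toContinuousLinearEquiv : E3 →L[ℝ] E3).hasFDerivAt).const_add x₀
    have h1 : HasFDerivAt V (fderiv ℝ V (x₀ + g y)) (x₀ + g y) := (hVd _).hasFDerivAt
    exact (g.symm.toContinuousLinearEquiv : E3 →L[ℝ] E3).hasFDerivAt.comp y (h1.comp y haff)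
  have hW1 : ContDiff ℝ 1 W := by
    have haff : ContDiff ℝ 1 (fun y : E3 => x₀ + g y) :=
      contDiff_const.add g.toContinuousLinearEquiv.toContinuousLinearMap.contDiff
    exact g.symm.toContinuousLinearEquiv.toContinuousLinearMap.contDiff.comp (hV1.comp haff)
  have hWinf : ∀ y : E3, fderiv ℝ W y (B' y) = B' (W y) := by
    intro y
    rw [(hWd y).fderiv]
    simp only [ContinuousLinearMap.comp_apply, ContinuousLinearEquiv.coe_coe, LinearIsometryEquiv.coe_toContinuousLinearEquiv]
    rw [hB'apply, g.apply_symm_apply]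
    -- `DV(x)(a × (x − x₀)) = a × V x` with `x = x₀ + g y`
    have h1 := hEq (x₀ + g y)
    rw [hAx, hAx, map_smul, add_sub_cancel_left] at h1
    have h2 : fderiv ℝ V (x₀ + g y) (cross a (g y)) = cross a (V (x₀ + g y)) := by
      have := congrArg (fun z => μ⁻¹ • z) h1
      simpa [smul_smul, inv_mul_cancel₀ hμ] using this
    rw [h2, hB'apply, hW, g.apply_symm_apply]
  have hWrot : ∀ y : E3, fderiv ℝ W y (rotGen y) = rotGen (W y) := by
    intro y
    have h1 := hWinf y
    rw [hc y, hc (W y), map_smul] at h1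
    exact smul_right_injective _ hc0 h1
  have hWaxi : IsAxisymmetric W := isAxisymmetric_of_fderiv_rotGen hW1 hWrot
  have hWsw : ∀ y : E3, swirl W y = 0 := by
    intro y
    rw [swirl_eq_inner_rotGen]
    show ⟪rotGen y, W y⟫ = 0
    -- `⟪W y, B' y⟫ = ⟪V x, a × (x − x₀)⟫ = 0` with `x = x₀ + g y` (global swirl identity)
    have h1 : ⟪W y, B' y⟫ = 0 := by
      rw [hB'apply, hW, hginner', g.apply_symm_apply]
      have h2 := hSw (x₀ + g y)
      rw [hAx, add_sub_cancel_left, real_inner_smul_right] at h2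
      exact (mul_eq_zero.1 h2).resolve_left hμ
    rw [hc y, real_inner_smul_right] at h1
    rw [real_inner_comm]
    exact (mul_eq_zero.1 h1).resolve_left hc0
  -- (5) the engine (KNSS 2009 Thm 5.2 with the tree's discharged facts F2, G1)
  exact CentreJet.eq_const_of_local_symmetry CentreJet.steadyNSGradientBounds CentreJet.steadyClassicalIsMild hNS hVan hB
    x₀ one_pos g (fun θ y _ => hWaxi θ y) (fun y _ => hWsw y)

/-- ★★ **R♯ `ShellReduction` BY NAME** (sketch v1.2 l.356, Defs twin verbatim): `SteadyShellRigidity → SteadyUnthreadedLiouville'`. -/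
theorem shellReduction : ShellReduction :=
  fun hC V p x₀ hNS hB hun => steadyUnthreadedLiouville_of_steadyShellRigidity hC V p x₀ hNS hB hun

end Summit.NavierStokesRegularity.NavierStokesRegularity.Theorems.PoloidalLiouville.AzimuthalCartan

end
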